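/-
Copyright (c) 2026 the pub-hodgecm-mathlib formalisation cell (harness21).  Prover seat hodgecm-mathlib-F0P3a-p08 (g20): road «S3-ram» (LEAD F0P3a-plan (g13);
owner F0P3a-p06), (T2) G-side organ (Cnt2′) (chair F0P3a-p07), organ (z6) «FIX-FINITE, BLOCK LITERAL», part (z6-g) «NON-CONTRACTION OF `γ₁ − u·1` FOR AN
ANISOTROPIC UNITARY `γ₁`» (the `hT` input of ★ p848920 `eq_root_of_latticeGraphIso_selfDual_lev_of_coe_eq_conj_endoGL`); 2026-09-02.
-/
import Literature.NumberTheory.Automorphic.UnitaryLatticeTreeAnisotropicBlockRootRegion   -- ★ p848920 (this seat); brings ★ AnisotropicPlane (`valued_pairing_self_eq_max_sq`, `pairing_diagonal_two_self`), ★ p848710 (`eval_charpoly_fin_two_eq_det_sub_smul_one`)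
import HarnessLib

/-!
# `γ₁ − u·1` CONTRACTS NO PRIMITIVE VECTOR BELOW HALF THE DISCRIMINANT DEPTH, for `γ₁` unitary for a residually anisotropic unimodular plane (the `hT` input of the root-region
# criterion of the anisotropic type-(2) literal) (Bruhat–Tits 1972 §10; Kottwitz 1986 §3)

Topic `NumberTheory/Automorphic`; namespace `Literature.NumberTheory.Automorphic.UnitaryLatticeTree`.  THEOREMS ONLY (no definition, no instance, no notation, no named fact,
no `sorry`); kernel lane `--supports stmt-HodgeConjecture-24833`; datum-free (`K` with `Valued K ℤᵐ⁰`, `σ` valuation-preserving, `|2| = 1`, principal units are squares).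
Cell `pub/hodgecm-mathlib` (D-0151), crux H413; road «S3-ram» (Literature seeding, count-neutral); (T2) G-side organ (Cnt2′), organ **(z6) «FIX-FINITE, BLOCK LITERAL»**, part
**(z6-g)**: ★ p848920 THM 4 closes the `hR` binder of ★ `strataCount_J₀_of_charpoly_block_raw_singleton` (F0P2-p02 (g14)) at the anisotropic literal `P·ι(γ₁,u)·P⁻¹` modulo
ONE input `hT : ∀ y ∈ 𝒪² primitive, ∃ i, |ϖ|^{d₀} ≤ |((γ₁ − u₀₀·1) y) i|`.  THIS FILE proves `hT` from `γ₁ ∈ U(σ, diag d)` (`diag d` residually anisotropic), `|2| = 1`,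
«principal units are squares» (`hsq`, ★ `exists_sq_eq_of_valued_sub_one_lt` at the CM place), «`χ_{γ₁}` has no root in `K`» (`hirr`) and `|ϖ|^{2d₀} ≤ |disc γ₁|` (root depth at
most half the discriminant depth — p03 (g18)'s REGIME TABLE: `d₀ = min(d_u, d_{γ})`), for ANY scalar `u`.

THE MATHEMATICS.  Write `γ = γ₁`, `δ = det γ` and `D = diag(d₀, d₁)`.  Unitarity `ᵗσ(γ) D γ = D` times `adj γ` reads `δ·ᵗσ(γ)D = D·adj γ`, i.e. (§2)
`γ₁₁ = δσ(γ₀₀)`, `γ₀₀ = δσ(γ₁₁)`, `d₁γ₁₀ = −δ d₀ σ(γ₀₁)`, and `|δ| = 1`; hence `|γ₁₀| = |γ₀₁|`, `a := γ₀₀ − γ₁₁ = −δσ(a)`, and with `b := 2γ₀₁`: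
**`d₁·disc γ = d₁(a² + 4γ₀₁γ₁₀) = −δ·(d₀ σ(b) b + d₁ σ(a) a) = −δ·⟨(b,a),(b,a)⟩_D`**, so by residual anisotropy (★ `valued_pairing_self_eq_max_sq`)
**`|disc γ| = max(|a|, |γ₀₁|)² =: m²`** (§3).  Now `T := γ − u·1` has `2T = s·1 + Z`, `s = tr γ − 2u`, `Z = !![a, b; 2γ₁₀, −a]`, all entries of `T` of size `≤ R := max(|s|, m)`,
and `4 det T = s² − disc γ`.  If `|s| ≠ m` then `|det T| = R²`; if `|s| = m` and `|s² − disc| < m²` then `disc∕s²` is a principal unit, hence a square (`hsq`), so `disc` is a square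
and `χ_γ` has the root `(tr + √disc)∕2` — excluded by `hirr`.  So **`|det T| = R²`** («`T` is CONFORMAL»), and the adjugate identity `adj(T)·T = det T` gives, for `y` primitive,
`R = R·‖y‖ ≤ ‖T y‖` (§1); finally `|ϖ|^{d₀} ≤ m ≤ R` from `|ϖ|^{2d₀} ≤ |disc| = m²`.
(The hypothesis `|ϖ|^{2d₀} ≤ |disc γ₁|` is where the COLLAPSE regime `γ₁ ∈ u·(deeper unitary)` is excluded: there `d₀ = v(u − 1) > v(disc)∕2` fails the census `sR = {r₀}`.)

* §1 `exists_mul_le_valued_mulVec_of_mul_le_det` (a `2 × 2` matrix with `‖A‖² ≤ |det A|` expands every vector: `∃ i, ‖A‖·‖y‖ ≤ |(Ay) i|`).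
* §2 `unitary_diagonal_two_relations`, `valued_det_eq_one_of_unitary_diagonal_two`, `valued_apply_one_zero_eq_of_unitary_diagonal_two`.
* §3 `disc_mul_eq_neg_det_mul_pairing_of_unitary_diagonal_two`, **`valued_disc_eq_max_sq_of_unitary_anisotropic`**.
* §4 **`exists_le_valued_sub_smul_one_mulVec_of_unitary_anisotropic`** (general lower bound `μ`, `μ² ≤ |disc|`),
  **`nonContraction_of_unitary_anisotropic`** (= the `hT` binder of ★ p848920 VERBATIM: `γ₁ : GL (Fin 2) K`, `u : GL (Fin 1) K`, `|ϖ|^{2d₀} ≤ |disc γ₁|`).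

HONEST LABEL: HC_CM is proved only modulo the 2 remaining named inputs (hLiu418 24832, h413 24833) until rung 0 closes; nothing printed is asserted here (elementary valuation
algebra); «S3-ram» has no books consequence.

## References
* [BruhatTits1972] F. Bruhat, J. Tits, *Groupes réductifs sur un corps local I*, Publ. Math. IHÉS 41 (1972), §10 (anisotropic groups: compact, no contraction).
* [Kottwitz1986] R. E. Kottwitz, *Base change for unit elements of Hecke algebras*, Compositio Math. 60 (1986), §3 (elliptic elements and their fixed lattices).
* [Jacobowitz1962] R. Jacobowitz, *Hermitian forms over local fields*, Amer. J. Math. 84 (1962), §7 (anisotropic unimodular planes).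
* [Rogawski1990] J. D. Rogawski, *Automorphic Representations of Unitary Groups in Three Variables*, Ann. of Math. Stud. 123 (1990), §4.9 pp. 54–56.
-/

set_option autoImplicit false

noncomputable section

open scoped Valued WithZero Matrix MatrixGroups

namespace Literature.NumberTheory.Automorphic.UnitaryLatticeTree

open Literature.NumberTheory.Automorphic Literature.NumberTheory.Automorphic.HermitianLattice Literature.NumberTheory.Rogawski1990

variable {K : Type*} [Field K] [Valued K ℤᵐ⁰]

/-! ## §1 A conformal `2 × 2` matrix expands every vector by its norm -/

/-- In `ℤᵐ⁰`: `c ≠ 0`, `c·x ≤ c·y ⇒ x ≤ y`. [folklore] -/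
private theorem le_of_mul_le_mul_left_withZero {c x y : ℤᵐ⁰} (hc : c ≠ 0) (h : c * x ≤ c * y) : x ≤ y := by
  have h' := mul_le_mul' (le_refl c⁻¹) h
  rwa [inv_mul_cancel_left₀ hc, inv_mul_cancel_left₀ hc] at h'

/-- In `ℤᵐ⁰`: `x·x ≤ y·y ⇒ x ≤ y`. [folklore] -/
private theorem le_of_mul_self_le_mul_self_withZero {x y : ℤᵐ⁰} (h : x * x ≤ y * y) : x ≤ y := by
  by_contra hlt
  rw [not_le] at hlt
  rcases eq_or_ne x 0 with hx | hx
  · rw [hx] at hlt; exact absurd hlt (not_lt.2 zero_le)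
  · exact absurd h (not_le.2 (lt_of_le_of_lt (mul_le_mul' le_rfl hlt.le) (mul_lt_mul_of_pos_right hlt (zero_lt_iff.2 hx))))

/-- **A `2 × 2` MATRIX WITH `‖A‖² ≤ |det A|` EXPANDS EVERY VECTOR BY `‖A‖`**: if all entries have size `≤ n` and `n² ≤ |det A|`, then `∃ i, n·max(|y₀|,|y₁|) ≤ |(A y) i|`
(adjugate identity `adj(A)·(A y) = det A · y`). [cite: BruhatTits1972, §10] -/
theorem exists_mul_le_valued_mulVec_of_mul_le_det (A : Matrix (Fin 2) (Fin 2) K) {n : ℤᵐ⁰} (hn : ∀ i j, Valued.v (A i j) ≤ n)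
    (hdet : n * n ≤ Valued.v A.det) (y : Fin 2 → K) :
    ∃ i, n * max (Valued.v (y 0)) (Valued.v (y 1)) ≤ Valued.v ((A *ᵥ y) i) := by
  rcases eq_or_ne n 0 with hn0 | hn0
  · exact ⟨0, by rw [hn0, zero_mul]; exact zero_le⟩
  set W := max (Valued.v ((A *ᵥ y) 0)) (Valued.v ((A *ᵥ y) 1)) with hW
  -- `det A · y = adj(A) · (A y)`
  have hadj : A.det • y = A.adjugate *ᵥ (A *ᵥ y) := by
    rw [Matrix.mulVec_mulVec, Matrix.adjugate_mul, Matrix.smul_mulVec, Matrix.one_mulVec]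
  have hadjn : ∀ i j, Valued.v (A.adjugate i j) ≤ n := fun i j => by
    rw [Matrix.adjugate_fin_two]
    fin_cases i <;> fin_cases j <;> simp [hn]
  have hk : ∀ k, Valued.v A.det * Valued.v (y k) ≤ n * W := fun k => by
    have e : A.det * y k = A.adjugate k 0 * (A *ᵥ y) 0 + A.adjugate k 1 * (A *ᵥ y) 1 := by
      have := congrFun hadj k
      rw [Pi.smul_apply, smul_eq_mul] at this
      rw [this, Matrix.mulVec, dotProduct, Fin.sum_univ_two]
    rw [← map_mul, e]
    refine Valuation.map_add_le _ ?_ ?_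
    · rw [map_mul]; exact mul_le_mul' (hadjn k 0) (le_max_left _ _)
    · rw [map_mul]; exact mul_le_mul' (hadjn k 1) (le_max_right _ _)
  -- `n²·|y k| ≤ |det A|·|y k| ≤ n·W`, so `n·|y k| ≤ W`
  have hk' : ∀ k, n * Valued.v (y k) ≤ W := fun k =>
    le_of_mul_le_mul_left_withZero hn0 (by rw [← mul_assoc]; exact (mul_le_mul' hdet le_rfl).trans (hk k))
  have hmax : n * max (Valued.v (y 0)) (Valued.v (y 1)) ≤ W := by
    rcases max_choice (Valued.v (y 0)) (Valued.v (y 1)) with h | h <;> rw [h]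
    exacts [hk' 0, hk' 1]
  rcases max_choice (Valued.v ((A *ᵥ y) 0)) (Valued.v ((A *ᵥ y) 1)) with h | h
  · exact ⟨0, by rw [← h]; exact hmax⟩
  · exact ⟨1, by rw [← h]; exact hmax⟩

/-! ## §2 The unitarity relations of `γ ∈ U(σ, diag d)` in rank 2 -/

omit [Valued K ℤᵐ⁰] in
/-- **THE RANK-2 UNITARITY RELATIONS** `δ·ᵗσ(γ)·D = D·adj(γ)` for `ᵗσ(γ) D γ = D`, `D = diag d`, `δ = det γ`, read entrywise:
`δσ(γ₀₀)d₀ = d₀γ₁₁`, `δσ(γ₁₀)d₁ = −d₀γ₀₁`, `δσ(γ₀₁)d₀ = −d₁γ₁₀`, `δσ(γ₁₁)d₁ = d₁γ₀₀`. [cite: Jacobowitz1962, §7] [cite: Rogawski1990, §4.9 p. 54] -/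
theorem unitary_diagonal_two_relations {σ : K →+* K} {d : Fin 2 → K} {γ : Matrix (Fin 2) (Fin 2) K}
    (hU : (γ.map σ)ᵀ * Matrix.diagonal d * γ = Matrix.diagonal d) :
    γ.det * σ (γ 0 0) * d 0 = d 0 * γ 1 1 ∧ γ.det * σ (γ 1 0) * d 1 = -(d 0 * γ 0 1) ∧
      γ.det * σ (γ 0 1) * d 0 = -(d 1 * γ 1 0) ∧ γ.det * σ (γ 1 1) * d 1 = d 1 * γ 0 0 := by
  have h : (γ.map σ)ᵀ * Matrix.diagonal d * (γ * γ.adjugate) = Matrix.diagonal d * γ.adjugate := by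
    rw [← Matrix.mul_assoc, hU]
  rw [Matrix.mul_adjugate, Matrix.mul_smul, Matrix.mul_one] at h
  have e := fun i j => congrFun (congrFun h i) j
  have e00 := e 0 0; have e01 := e 0 1; have e10 := e 1 0; have e11 := e 1 1
  simp [Matrix.mul_apply, Matrix.adjugate_fin_two, Matrix.diagonal, Matrix.transpose_apply, Matrix.map_apply] at e00 e01 e10 e11
  refine ⟨?_, ?_, ?_, ?_⟩
  · linear_combination e00
  · linear_combination e01
  · linear_combination e10
  · linear_combination e11

/-- `|det γ| = 1` for `γ ∈ U(σ, diag d)` (`|d i| = 1`, `σ` valuation-preserving). [cite: Jacobowitz1962, §7] -/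
theorem valued_det_eq_one_of_unitary_diagonal_two {σ : K →+* K} (hvσ : ∀ a, Valued.v (σ a) = Valued.v a) {d : Fin 2 → K} (hd : ∀ i, Valued.v (d i) = 1)
    {γ : Matrix (Fin 2) (Fin 2) K} (hU : (γ.map σ)ᵀ * Matrix.diagonal d * γ = Matrix.diagonal d) : Valued.v γ.det = 1 := by
  have h := congrArg Matrix.det hU
  rw [Matrix.det_mul, Matrix.det_mul, Matrix.det_transpose, ← RingHom.mapMatrix_apply, ← RingHom.map_det] at h
  have hD : Valued.v (Matrix.diagonal d).det = 1 := by
    rw [Matrix.det_diagonal, map_prod, Finset.prod_eq_one fun i _ => hd i]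
  have hv := congrArg Valued.v h
  rw [map_mul, map_mul, hvσ, hD, mul_one] at hv
  rcases lt_trichotomy (Valued.v γ.det) 1 with hlt | heq | hgt
  · exact absurd hv (ne_of_lt (mul_lt_one_of_nonneg_of_lt_one_left zero_le hlt hlt.le))
  · exact heq
  · exact absurd hv (ne_of_gt (one_lt_mul_of_lt_of_le hgt hgt.le))

/-- `|γ₁₀| = |γ₀₁|` for `γ ∈ U(σ, diag d)` (`d₁γ₁₀ = −δ d₀ σ(γ₀₁)`). [cite: Jacobowitz1962, §7] -/
theorem valued_apply_one_zero_eq_of_unitary_diagonal_two {σ : K →+* K} (hvσ : ∀ a, Valued.v (σ a) = Valued.v a) {d : Fin 2 → K} (hd : ∀ i, Valued.v (d i) = 1)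
    {γ : Matrix (Fin 2) (Fin 2) K} (hU : (γ.map σ)ᵀ * Matrix.diagonal d * γ = Matrix.diagonal d) : Valued.v (γ 1 0) = Valued.v (γ 0 1) := by
  obtain ⟨-, -, e10, -⟩ := unitary_diagonal_two_relations hU
  have hv := congrArg Valued.v e10
  rw [map_mul, map_mul, valued_det_eq_one_of_unitary_diagonal_two hvσ hd hU, hvσ, hd, one_mul, mul_one, Valuation.map_neg, map_mul, hd, one_mul] at hv
  exact hv.symm

/-! ## §3 The discriminant of an anisotropic unitary `γ` has the size of `γ − ½tr γ` squared -/

omit [Valued K ℤᵐ⁰] in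
/-- **`d₀d₁·disc γ = −δ·d₀·⟨(2γ₀₁, γ₀₀ − γ₁₁), (2γ₀₁, γ₀₀ − γ₁₁)⟩_{diag d}`** for `γ ∈ U(σ, diag d)`: the traceless part `Z = γ − ½trγ` satisfies `D Z = −δ Z^* D`.
[cite: Jacobowitz1962, §7] [cite: Rogawski1990, §4.9 p. 54] -/
theorem disc_mul_eq_neg_det_mul_pairing_of_unitary_diagonal_two {σ : K →+* K} {d : Fin 2 → K} {γ : Matrix (Fin 2) (Fin 2) K}
    (hU : (γ.map σ)ᵀ * Matrix.diagonal d * γ = Matrix.diagonal d) :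
    d 0 * d 1 * (γ.trace ^ 2 - 4 * γ.det) =
      -(γ.det * (d 0 * pairing σ (Matrix.diagonal d) ![2 * γ 0 1, γ 0 0 - γ 1 1] ![2 * γ 0 1, γ 0 0 - γ 1 1])) := by
  obtain ⟨e00, -, e10, e11⟩ := unitary_diagonal_two_relations hU
  rw [pairing_diagonal_two_self, Matrix.trace_fin_two, Matrix.det_fin_two]
  simp only [Matrix.cons_val_zero, Matrix.cons_val_one, map_mul, map_sub, map_ofNat]
  rw [Matrix.det_fin_two] at e00 e10 e11
  linear_combination (4 * d 0 * γ 0 1) * e10 + (d 1 * (γ 0 0 - γ 1 1)) * e00 - (d 0 * (γ 0 0 - γ 1 1)) * e11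

/-- **`|disc γ| = max(|γ₀₀ − γ₁₁|, |γ₀₁|)²`** for `γ ∈ U(σ, diag d)` with `diag d` residually anisotropic and `|2| = 1` — no cancellation in `(γ₀₀ − γ₁₁)² + 4γ₀₁γ₁₀`.
[cite: BruhatTits1972, §10] [cite: Jacobowitz1962, §7] -/
theorem valued_disc_eq_max_sq_of_unitary_anisotropic {σ : K →+* K} (hvσ : ∀ a, Valued.v (σ a) = Valued.v a) (h2 : Valued.v (2 : K) = 1)
    {d : Fin 2 → K} (hd : ∀ i, Valued.v (d i) = 1)
    (hanis₀ : ∀ c : K, Valued.v c ≤ 1 → Valued.v (d 0 + d 1 * (σ c * c)) = 1)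
    (hanis₁ : ∀ c : K, Valued.v c ≤ 1 → Valued.v (d 0 * (σ c * c) + d 1) = 1)
    {γ : Matrix (Fin 2) (Fin 2) K} (hU : (γ.map σ)ᵀ * Matrix.diagonal d * γ = Matrix.diagonal d) :
    Valued.v (γ.trace ^ 2 - 4 * γ.det) =
      max (Valued.v (γ 0 0 - γ 1 1)) (Valued.v (γ 0 1)) * max (Valued.v (γ 0 0 - γ 1 1)) (Valued.v (γ 0 1)) := by
  have hδ := valued_det_eq_one_of_unitary_diagonal_two hvσ hd hU
  have key := congrArg Valued.v (disc_mul_eq_neg_det_mul_pairing_of_unitary_diagonal_two (σ := σ) hU)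
  rw [map_mul, map_mul, hd, hd, one_mul, one_mul, Valuation.map_neg, map_mul, hδ, one_mul, map_mul, hd, one_mul] at key
  rw [key]
  by_cases hx : (![2 * γ 0 1, γ 0 0 - γ 1 1] : Fin 2 → K) = 0
  · have h01 : 2 * γ 0 1 = 0 := by simpa using congrFun hx 0
    have h00 : γ 0 0 - γ 1 1 = 0 := by simpa using congrFun hx 1
    have h01' : γ 0 1 = 0 := by
      rcases mul_eq_zero.1 h01 with h | h
      · exact absurd (congrArg Valued.v h) (by rw [h2, map_zero]; exact one_ne_zero)
      · exact h
    simp [h00, h01']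
  · rw [valued_pairing_self_eq_max_sq hvσ hanis₀ hanis₁ hx]
    simp only [Matrix.cons_val_zero, Matrix.cons_val_one, map_mul, h2, one_mul]
    rw [max_comm]

/-! ## §4 Non-contraction -/

set_option maxHeartbeats 800000 in
-- budget only: many valuation case splits.
/-- **`γ − u·1` EXPANDS PRIMITIVE VECTORS AT LEAST BY `√|disc γ|`**: for `γ ∈ U(σ, diag d)` (`diag d` residually anisotropic), `|2| = 1`, principal units squares (`hsq`), `χ_γ`
rootless in `K` (`hirr`), any scalar `u`, and any `μ` with `μ² ≤ |disc γ|`: for `y` with `‖y‖ = 1`, `∃ i, μ ≤ |((γ − u·1) y) i|` — `T = γ − u·1` is CONFORMAL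
(`|det T| = ‖T‖²`; the only possible cancellation would make `disc γ` a square). [cite: BruhatTits1972, §10] [cite: Kottwitz1986, §3] -/
theorem exists_le_valued_sub_smul_one_mulVec_of_unitary_anisotropic {σ : K →+* K} (hvσ : ∀ a, Valued.v (σ a) = Valued.v a) (h2 : Valued.v (2 : K) = 1)
    (hsq : ∀ t : K, Valued.v (t - 1) < 1 → IsSquare t)
    {d : Fin 2 → K} (hd : ∀ i, Valued.v (d i) = 1)
    (hanis₀ : ∀ c : K, Valued.v c ≤ 1 → Valued.v (d 0 + d 1 * (σ c * c)) = 1)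
    (hanis₁ : ∀ c : K, Valued.v c ≤ 1 → Valued.v (d 0 * (σ c * c) + d 1) = 1)
    {γ : Matrix (Fin 2) (Fin 2) K} (hU : (γ.map σ)ᵀ * Matrix.diagonal d * γ = Matrix.diagonal d)
    (hirr : ∀ x : K, ¬ γ.charpoly.IsRoot x) (u : K) {μ : ℤᵐ⁰} (hμ : μ * μ ≤ Valued.v (γ.trace ^ 2 - 4 * γ.det))
    (y : Fin 2 → K) (hy : ∀ i, Valued.v (y i) ≤ 1) (hy1 : ∃ i, Valued.v (y i) = 1) :
    ∃ i, μ ≤ Valued.v (((γ - u • (1 : Matrix (Fin 2) (Fin 2) K)) *ᵥ y) i) := by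
  rcases eq_or_ne μ 0 with hμ0 | hμ0
  · exact ⟨0, by rw [hμ0]; exact zero_le⟩
  have h20 : (2 : K) ≠ 0 := fun h => by rw [h, map_zero] at h2; exact zero_ne_one h2
  have h4 : Valued.v (4 : K) = 1 := by rw [show (4 : K) = 2 * 2 by norm_num, map_mul, h2, one_mul]
  -- names
  set T : Matrix (Fin 2) (Fin 2) K := γ - u • (1 : Matrix (Fin 2) (Fin 2) K) with hT
  set a : K := γ 0 0 - γ 1 1 with ha
  set s : K := γ 0 0 + γ 1 1 - 2 * u with hs
  set e : K := γ.trace ^ 2 - 4 * γ.det with he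
  set m : ℤᵐ⁰ := max (Valued.v a) (Valued.v (γ 0 1)) with hm
  have hem : Valued.v e = m * m := valued_disc_eq_max_sq_of_unitary_anisotropic hvσ h2 hd hanis₀ hanis₁ hU
  have h10 : Valued.v (γ 1 0) = Valued.v (γ 0 1) := valued_apply_one_zero_eq_of_unitary_diagonal_two hvσ hd hU
  -- `μ ≤ m`
  have hμm : μ ≤ m := le_of_mul_self_le_mul_self_withZero (by rw [← hem]; exact hμ)
  have hm0 : m ≠ 0 := fun h0 => hμ0 (le_antisymm (by rw [← h0]; exact hμm) zero_le)
  -- entries of `T` and `4 det T = s² − e`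
  have hT00 : T 0 0 = γ 0 0 - u := by simp [hT]
  have hT11 : T 1 1 = γ 1 1 - u := by simp [hT]
  have hT01 : T 0 1 = γ 0 1 := by simp [hT]
  have hT10 : T 1 0 = γ 1 0 := by simp [hT]
  have hsa : s + a = 2 * (γ 0 0 - u) := by rw [hs, ha]; ring
  have hsa' : s - a = 2 * (γ 1 1 - u) := by rw [hs, ha]; ring
  have hdetT : 4 * T.det = s ^ 2 - e := by
    rw [Matrix.det_fin_two, hT00, hT11, hT01, hT10, he, Matrix.trace_fin_two, Matrix.det_fin_two, hs]; ring
  have hvT00 : Valued.v (T 0 0) = Valued.v (s + a) := by rw [hsa, map_mul, h2, one_mul, hT00]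
  have hvT11 : Valued.v (T 1 1) = Valued.v (s - a) := by rw [hsa', map_mul, h2, one_mul, hT11]
  have hvdetT : Valued.v T.det = Valued.v (s ^ 2 - e) := by rw [← hdetT, map_mul, h4, one_mul]
  -- `R := max(|s|, m)` bounds the entries of `T`
  set R : ℤᵐ⁰ := max (Valued.v s) m with hR
  have ha_le : Valued.v a ≤ m := le_max_left _ _
  have hb_le : Valued.v (γ 0 1) ≤ m := le_max_right _ _
  have hent : ∀ i j, Valued.v (T i j) ≤ R := fun i j => by
    fin_cases i <;> fin_cases j
    · change Valued.v (T 0 0) ≤ R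
      rw [hvT00]; exact (Valuation.map_add_le _ (le_max_left _ _) (ha_le.trans (le_max_right _ _)))
    · change Valued.v (T 0 1) ≤ R
      rw [hT01]; exact hb_le.trans (le_max_right _ _)
    · change Valued.v (T 1 0) ≤ R
      rw [hT10, h10]; exact hb_le.trans (le_max_right _ _)
    · change Valued.v (T 1 1) ≤ R
      rw [hvT11]; exact (Valuation.map_sub_le _ (le_max_left _ _) (ha_le.trans (le_max_right _ _)))
  -- `|det T| = R²` (conformality)
  have hvs2 : Valued.v (s ^ 2) = Valued.v s * Valued.v s := by rw [map_pow, pow_two]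
  have hdet : R * R ≤ Valued.v T.det := by
    rw [hvdetT]
    rcases lt_trichotomy (Valued.v s) m with hlt | heq | hgt
    · -- `|s| < m`: `|s² − e| = |e| = m²`
      have hR' : R = m := max_eq_right hlt.le
      have hlt2 : Valued.v (s ^ 2) < Valued.v e := by
        rw [hvs2, hem]
        exact lt_of_le_of_lt (mul_le_mul' le_rfl hlt.le) (mul_lt_mul_of_pos_right hlt (zero_lt_iff.2 hm0))
      rw [Valuation.map_sub_eq_of_lt_right _ hlt2, hem, hR']
    · -- `|s| = m`: cancellation would make `disc` a square
      have hR' : R = m := by rw [hR, heq, max_self]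
      rw [hR']
      by_contra hlt
      rw [not_le] at hlt
      have hs0 : s ≠ 0 := fun h0 => hm0 (by rw [← heq, h0, map_zero])
      have hvs : Valued.v (s ^ 2) = m * m := by rw [hvs2, heq]
      -- `t := e / s²` is a principal unit
      have ht1 : Valued.v (e / s ^ 2 - 1) < 1 := by
        have hs20 : s ^ 2 ≠ 0 := pow_ne_zero 2 hs0
        rw [div_sub_one hs20, map_div₀, hvs, ← Valuation.map_neg, neg_sub]
        have hpos : (0 : ℤᵐ⁰) < m * m := zero_lt_iff.2 (mul_ne_zero hm0 hm0)
        rwa [div_lt_one₀ hpos]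
      obtain ⟨r, hr⟩ := hsq _ ht1
      -- `disc = (r s)²`, so `χ_γ` has the root `(tr + r s) / 2`
      have hw : (r * s) * (r * s) = γ.trace ^ 2 - 4 * γ.det := by
        rw [← he]
        have hs20 : s ^ 2 ≠ 0 := pow_ne_zero 2 hs0
        have : e = r * r * s ^ 2 := by rw [← hr, div_mul_cancel₀ e hs20]
        rw [this]; ring
      refine hirr ((γ.trace + r * s) / 2) ?_
      rw [Polynomial.IsRoot.def, eval_charpoly_fin_two_eq_det_sub_smul_one, Matrix.det_fin_two]
      simp only [Matrix.sub_apply, Matrix.smul_apply, Matrix.one_apply_eq, Matrix.one_apply_ne (by decide : (0 : Fin 2) ≠ 1),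
        Matrix.one_apply_ne (by decide : (1 : Fin 2) ≠ 0), smul_eq_mul, mul_one, mul_zero, sub_zero]
      rw [Matrix.trace_fin_two, Matrix.det_fin_two] at hw
      rw [Matrix.trace_fin_two]
      field_simp
      linear_combination hw
    · -- `|s| > m`: `|s² − e| = |s|²`
      have hR' : R = Valued.v s := max_eq_left hgt.le
      have hlt2 : Valued.v e < Valued.v (s ^ 2) := by
        rw [hvs2, hem]
        exact lt_of_le_of_lt (mul_le_mul' le_rfl hgt.le) (mul_lt_mul_of_pos_right hgt (lt_of_le_of_lt zero_le hgt))
      rw [Valuation.map_sub_eq_of_lt_left _ hlt2, hvs2, hR']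
  -- expand the primitive vector
  obtain ⟨i, hi⟩ := exists_mul_le_valued_mulVec_of_mul_le_det T hent hdet y
  have hY : max (Valued.v (y 0)) (Valued.v (y 1)) = 1 := by
    refine le_antisymm (max_le (hy 0) (hy 1)) ?_
    obtain ⟨k, hk⟩ := hy1
    fin_cases k
    · exact le_max_of_le_left (le_of_eq hk.symm)
    · exact le_max_of_le_right (le_of_eq hk.symm)
  rw [hY, mul_one] at hi
  exact ⟨i, (hμm.trans (le_max_right _ _)).trans hi⟩

/-- **THE `hT` BINDER OF ★ p848920 `eq_root_of_latticeGraphIso_selfDual_lev_of_coe_eq_conj_endoGL` FOR A UNITARY ANISOTROPIC `γ₁`**: with `γ₁ ∈ U(σ, diag d)`, `|2| = 1`,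
`hsq`, `hirr` and `|ϖ|^{2d₀} ≤ |disc γ₁|` (root depth at most half the discriminant depth): `γ₁ − u₀₀·1` contracts no primitive vector of `𝒪²` below `ϖ^{d₀}`.
[cite: BruhatTits1972, §10] [cite: Kottwitz1986, §3] [cite: Rogawski1990, §4.9 pp. 54–56] -/
theorem nonContraction_of_unitary_anisotropic {σ : K →+* K} (hvσ : ∀ a, Valued.v (σ a) = Valued.v a) (h2 : Valued.v (2 : K) = 1)
    (hsq : ∀ t : K, Valued.v (t - 1) < 1 → IsSquare t)
    {d : Fin 2 → K} (hd : ∀ i, Valued.v (d i) = 1)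
    (hanis₀ : ∀ c : K, Valued.v c ≤ 1 → Valued.v (d 0 + d 1 * (σ c * c)) = 1)
    (hanis₁ : ∀ c : K, Valued.v c ≤ 1 → Valued.v (d 0 * (σ c * c) + d 1) = 1)
    (γ₁ : GL (Fin 2) K) (hγU : γ₁ ∈ unitaryGroupOfForm σ (Matrix.diagonal d))
    (hirr : ∀ x : K, ¬ (γ₁ : Matrix (Fin 2) (Fin 2) K).charpoly.IsRoot x) (u : GL (Fin 1) K)
    {ϖ : K} {d₀ : ℕ} (hdisc : Valued.v ϖ ^ (2 * d₀) ≤ Valued.v ((γ₁ : Matrix (Fin 2) (Fin 2) K).trace ^ 2 - 4 * (γ₁ : Matrix (Fin 2) (Fin 2) K).det)) :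
    ∀ y : Fin 2 → K, (∀ i, Valued.v (y i) ≤ 1) → (∃ i, Valued.v (y i) = 1) →
      ∃ i, Valued.v ϖ ^ d₀ ≤ Valued.v ((((γ₁ : Matrix (Fin 2) (Fin 2) K) - (u : Matrix (Fin 1) (Fin 1) K) 0 0 • (1 : Matrix (Fin 2) (Fin 2) K)) *ᵥ y) i) :=
  fun y hy hy1 => exists_le_valued_sub_smul_one_mulVec_of_unitary_anisotropic hvσ h2 hsq hd hanis₀ hanis₁ hγU hirr _
    (by rw [← pow_add, ← two_mul]; exact hdisc) y hy hy1

/-! ## §5 (ED. 2) The sharp form: `γ − u·1` is conformal in every regime, so non-contraction needs only `‖γ − u·1‖ ≥ μ` -/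

set_option maxHeartbeats 800000 in
-- budget only: many valuation case splits.
/-- **(ED. 2) `γ − u·1` IS CONFORMAL — SHARP NON-CONTRACTION**: for `γ ∈ U(σ, diag d)` (`diag d` residually anisotropic), `|2| = 1`, principal units squares, `χ_γ` rootless
in `K`, any scalar `u` and any `μ` bounded by SOME ENTRY of `T = γ − u·1` (`∃ i j, μ ≤ |T i j|`): for `y` with `‖y‖ = 1`, `∃ i, μ ≤ |(T y) i|`.  (`|det T| = ‖T‖²` in all
three regimes `|tr γ − 2u| <, =, > √|disc γ|`; ED. 1's `μ² ≤ |disc γ|` covered the last two only.)  With `μ = |ϖ|^{d₀}`, `d₀ = v_min(T)` (the composition pen's dictionary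
«`d₀ := v_min(γ₁ − u₀₀·1)`») this is the `hT` input of ★ p848920 in EVERY regime where the root depth is the block depth. [cite: BruhatTits1972, §10] [cite: Kottwitz1986, §3] -/
theorem exists_le_valued_sub_smul_one_mulVec_of_le_entry {σ : K →+* K} (hvσ : ∀ a, Valued.v (σ a) = Valued.v a) (h2 : Valued.v (2 : K) = 1)
    (hsq : ∀ t : K, Valued.v (t - 1) < 1 → IsSquare t)
    {d : Fin 2 → K} (hd : ∀ i, Valued.v (d i) = 1)
    (hanis₀ : ∀ c : K, Valued.v c ≤ 1 → Valued.v (d 0 + d 1 * (σ c * c)) = 1)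
    (hanis₁ : ∀ c : K, Valued.v c ≤ 1 → Valued.v (d 0 * (σ c * c) + d 1) = 1)
    {γ : Matrix (Fin 2) (Fin 2) K} (hU : (γ.map σ)ᵀ * Matrix.diagonal d * γ = Matrix.diagonal d)
    (hirr : ∀ x : K, ¬ γ.charpoly.IsRoot x) (u : K) {μ : ℤᵐ⁰} (hμ : ∃ i j, μ ≤ Valued.v ((γ - u • (1 : Matrix (Fin 2) (Fin 2) K)) i j))
    (y : Fin 2 → K) (hy : ∀ i, Valued.v (y i) ≤ 1) (hy1 : ∃ i, Valued.v (y i) = 1) :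
    ∃ i, μ ≤ Valued.v (((γ - u • (1 : Matrix (Fin 2) (Fin 2) K)) *ᵥ y) i) := by
  rcases eq_or_ne μ 0 with hμ0 | hμ0
  · exact ⟨0, by rw [hμ0]; exact zero_le⟩
  have h20 : (2 : K) ≠ 0 := fun h => by rw [h, map_zero] at h2; exact zero_ne_one h2
  have h4 : Valued.v (4 : K) = 1 := by rw [show (4 : K) = 2 * 2 by norm_num, map_mul, h2, one_mul]
  -- names
  set T : Matrix (Fin 2) (Fin 2) K := γ - u • (1 : Matrix (Fin 2) (Fin 2) K) with hT
  set a : K := γ 0 0 - γ 1 1 with ha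
  set s : K := γ 0 0 + γ 1 1 - 2 * u with hs
  set e : K := γ.trace ^ 2 - 4 * γ.det with he
  set m : ℤᵐ⁰ := max (Valued.v a) (Valued.v (γ 0 1)) with hm
  have hem : Valued.v e = m * m := valued_disc_eq_max_sq_of_unitary_anisotropic hvσ h2 hd hanis₀ hanis₁ hU
  have h10 : Valued.v (γ 1 0) = Valued.v (γ 0 1) := valued_apply_one_zero_eq_of_unitary_diagonal_two hvσ hd hU
  -- entries of `T` and `4 det T = s² − e`
  have hT00 : T 0 0 = γ 0 0 - u := by simp [hT]
  have hT11 : T 1 1 = γ 1 1 - u := by simp [hT]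
  have hT01 : T 0 1 = γ 0 1 := by simp [hT]
  have hT10 : T 1 0 = γ 1 0 := by simp [hT]
  have hsa : s + a = 2 * (γ 0 0 - u) := by rw [hs, ha]; ring
  have hsa' : s - a = 2 * (γ 1 1 - u) := by rw [hs, ha]; ring
  have hdetT : 4 * T.det = s ^ 2 - e := by
    rw [Matrix.det_fin_two, hT00, hT11, hT01, hT10, he, Matrix.trace_fin_two, Matrix.det_fin_two, hs]; ring
  have hvT00 : Valued.v (T 0 0) = Valued.v (s + a) := by rw [hsa, map_mul, h2, one_mul, hT00]
  have hvT11 : Valued.v (T 1 1) = Valued.v (s - a) := by rw [hsa', map_mul, h2, one_mul, hT11]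
  have hvdetT : Valued.v T.det = Valued.v (s ^ 2 - e) := by rw [← hdetT, map_mul, h4, one_mul]
  -- `R := max(|s|, m)` bounds the entries of `T`
  set R : ℤᵐ⁰ := max (Valued.v s) m with hR
  have ha_le : Valued.v a ≤ m := le_max_left _ _
  have hb_le : Valued.v (γ 0 1) ≤ m := le_max_right _ _
  have hent : ∀ i j, Valued.v (T i j) ≤ R := fun i j => by
    fin_cases i <;> fin_cases j
    · change Valued.v (T 0 0) ≤ R
      rw [hvT00]; exact (Valuation.map_add_le _ (le_max_left _ _) (ha_le.trans (le_max_right _ _)))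
    · change Valued.v (T 0 1) ≤ R
      rw [hT01]; exact hb_le.trans (le_max_right _ _)
    · change Valued.v (T 1 0) ≤ R
      rw [hT10, h10]; exact hb_le.trans (le_max_right _ _)
    · change Valued.v (T 1 1) ≤ R
      rw [hvT11]; exact (Valuation.map_sub_le _ (le_max_left _ _) (ha_le.trans (le_max_right _ _)))
  -- `μ ≤ R`, so `R ≠ 0`
  have hμR : μ ≤ R := by obtain ⟨i, j, hij⟩ := hμ; exact hij.trans (hent i j)
  have hR0 : R ≠ 0 := fun h0 => hμ0 (le_antisymm (by rw [← h0]; exact hμR) zero_le)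
  -- `|det T| = R²` (conformality, all three regimes)
  have hvs2 : Valued.v (s ^ 2) = Valued.v s * Valued.v s := by rw [map_pow, pow_two]
  have hdet : R * R ≤ Valued.v T.det := by
    rw [hvdetT]
    rcases lt_trichotomy (Valued.v s) m with hlt | heq | hgt
    · -- `|s| < m`: `|s² − e| = |e| = m²`
      have hR' : R = m := max_eq_right hlt.le
      have hm0 : m ≠ 0 := by rw [← hR']; exact hR0
      have hlt2 : Valued.v (s ^ 2) < Valued.v e := by
        rw [hvs2, hem]
        exact lt_of_le_of_lt (mul_le_mul' le_rfl hlt.le) (mul_lt_mul_of_pos_right hlt (zero_lt_iff.2 hm0))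
      rw [Valuation.map_sub_eq_of_lt_right _ hlt2, hem, hR']
    · -- `|s| = m`: cancellation would make `disc` a square
      have hR' : R = m := by rw [hR, heq, max_self]
      have hm0 : m ≠ 0 := by rw [← hR']; exact hR0
      rw [hR']
      by_contra hlt
      rw [not_le] at hlt
      have hs0 : s ≠ 0 := fun h0 => hm0 (by rw [← heq, h0, map_zero])
      have hvs : Valued.v (s ^ 2) = m * m := by rw [hvs2, heq]
      have ht1 : Valued.v (e / s ^ 2 - 1) < 1 := by
        have hs20 : s ^ 2 ≠ 0 := pow_ne_zero 2 hs0
        rw [div_sub_one hs20, map_div₀, hvs, ← Valuation.map_neg, neg_sub]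
        have hpos : (0 : ℤᵐ⁰) < m * m := zero_lt_iff.2 (mul_ne_zero hm0 hm0)
        rwa [div_lt_one₀ hpos]
      obtain ⟨r, hr⟩ := hsq _ ht1
      have hw : (r * s) * (r * s) = γ.trace ^ 2 - 4 * γ.det := by
        rw [← he]
        have hs20 : s ^ 2 ≠ 0 := pow_ne_zero 2 hs0
        have : e = r * r * s ^ 2 := by rw [← hr, div_mul_cancel₀ e hs20]
        rw [this]; ring
      refine hirr ((γ.trace + r * s) / 2) ?_
      rw [Polynomial.IsRoot.def, eval_charpoly_fin_two_eq_det_sub_smul_one, Matrix.det_fin_two]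
      simp only [Matrix.sub_apply, Matrix.smul_apply, Matrix.one_apply_eq, Matrix.one_apply_ne (by decide : (0 : Fin 2) ≠ 1),
        Matrix.one_apply_ne (by decide : (1 : Fin 2) ≠ 0), smul_eq_mul, mul_one, mul_zero, sub_zero]
      rw [Matrix.trace_fin_two, Matrix.det_fin_two] at hw
      rw [Matrix.trace_fin_two]
      field_simp
      linear_combination hw
    · -- `|s| > m`: `|s² − e| = |s|²`
      have hR' : R = Valued.v s := max_eq_left hgt.le
      have hlt2 : Valued.v e < Valued.v (s ^ 2) := by
        rw [hvs2, hem]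
        exact lt_of_le_of_lt (mul_le_mul' le_rfl hgt.le) (mul_lt_mul_of_pos_right hgt (lt_of_le_of_lt zero_le hgt))
      rw [Valuation.map_sub_eq_of_lt_left _ hlt2, hvs2, hR']
  -- expand the primitive vector
  obtain ⟨i, hi⟩ := exists_mul_le_valued_mulVec_of_mul_le_det T hent hdet y
  have hY : max (Valued.v (y 0)) (Valued.v (y 1)) = 1 := by
    refine le_antisymm (max_le (hy 0) (hy 1)) ?_
    obtain ⟨k, hk⟩ := hy1
    fin_cases k
    · exact le_max_of_le_left (le_of_eq hk.symm)
    · exact le_max_of_le_right (le_of_eq hk.symm)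
  rw [hY, mul_one] at hi
  exact ⟨i, hμR.trans hi⟩

/-- **(ED. 2) THE `hT` BINDER OF ★ p848920 IN THE BLOCK-DEPTH CURRENCY**: with `γ₁ ∈ U(σ, diag d)`, `|2| = 1`, `hsq`, `hirr` and «some entry of `γ₁ − u₀₀·1` has size
`≥ |ϖ|^{d₀}`» (e.g. `d₀ = v_min(γ₁ − u₀₀·1)`, the composition pen's dictionary): `γ₁ − u₀₀·1` contracts no primitive vector of `𝒪²` below `ϖ^{d₀}` — every regime, no
discriminant hypothesis. [cite: BruhatTits1972, §10] [cite: Kottwitz1986, §3] [cite: Rogawski1990, §4.9 pp. 54–56] -/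
theorem nonContraction_of_unitary_anisotropic_of_entry {σ : K →+* K} (hvσ : ∀ a, Valued.v (σ a) = Valued.v a) (h2 : Valued.v (2 : K) = 1)
    (hsq : ∀ t : K, Valued.v (t - 1) < 1 → IsSquare t)
    {d : Fin 2 → K} (hd : ∀ i, Valued.v (d i) = 1)
    (hanis₀ : ∀ c : K, Valued.v c ≤ 1 → Valued.v (d 0 + d 1 * (σ c * c)) = 1)
    (hanis₁ : ∀ c : K, Valued.v c ≤ 1 → Valued.v (d 0 * (σ c * c) + d 1) = 1)
    (γ₁ : GL (Fin 2) K) (hγU : γ₁ ∈ unitaryGroupOfForm σ (Matrix.diagonal d))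
    (hirr : ∀ x : K, ¬ (γ₁ : Matrix (Fin 2) (Fin 2) K).charpoly.IsRoot x) (u : GL (Fin 1) K) {ϖ : K} {d₀ : ℕ}
    (hA' : ∃ i j, Valued.v ϖ ^ d₀ ≤ Valued.v (((γ₁ : Matrix (Fin 2) (Fin 2) K) - (u : Matrix (Fin 1) (Fin 1) K) 0 0 • (1 : Matrix (Fin 2) (Fin 2) K)) i j)) :
    ∀ y : Fin 2 → K, (∀ i, Valued.v (y i) ≤ 1) → (∃ i, Valued.v (y i) = 1) →
      ∃ i, Valued.v ϖ ^ d₀ ≤ Valued.v ((((γ₁ : Matrix (Fin 2) (Fin 2) K) - (u : Matrix (Fin 1) (Fin 1) K) 0 0 • (1 : Matrix (Fin 2) (Fin 2) K)) *ᵥ y) i) :=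
  fun y hy hy1 => exists_le_valued_sub_smul_one_mulVec_of_le_entry hvσ h2 hsq hd hanis₀ hanis₁ hγU hirr _ hA' y hy hy1

end Literature.NumberTheory.Automorphic.UnitaryLatticeTree

end
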